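/-
Copyright (c) 2026. All rights reserved.
Released under Apache 2.0 license as described in the file LICENSE.
Authors: abc-iut cell, wave-2 prover seat abc-iut-L3-t11 (proof-only tool file for discharge item G4b of
plan/L3/DISCHARGE-L3.md).
-/
import Mathlib.Combinatorics.SimpleGraph.Acyclic
import Literature.AnabelianGeometry.SemiGraphs.SemiGraph

/-!
# Semi-graphs: walking along paths of the barycentric subdivision ([SemiAnbd] §1, pp. 11–13, 20)

Mochizuki, *Semi-graphs of Anabelioids*, Publ. RIMS **42** (2006) 221–322, §1, author's manuscript
pp. 11–13 (semi-graphs, their topological space = barycentric subdivision, trees) and p. 20 (Lemma 1.8)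
[cite: MochizukiSemiAnbd2006, §1 pp.11-13]. PROOF-ONLY tool file (no definitions) over abc-iut-L3-t1's
`SemiGraph.lean` (p403772), used by the Lemma 1.8 companions `FreeGroupsAndActionsProofs*.lean`:

* `branch_eq_of_ne_of_ne` — an edge has exactly two branches, so "the other branch" is determined;
* `branch_unique_of_isAcyclic` — **in a tree an edge has at most one branch at a given vertex** (else the
  circuit `v – b₁ – e – b₂ – v`; here: two distinct paths `v – bᵢ – e` contradict path uniqueness);
* `step_vertex` / `step_edge` / `step_branch`, `getVert_add_two_ne`, `lt_length_of_getVert_ne` — one step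
  along a walk of `G.subdivision` from a vertex-, edge-, branch-point; no back-tracking on a path;
* `path_between_vertices_shape` — **the shape of a geodesic between two distinct vertices**: the nodes
  follow the pattern vertex – branch – edge – branch – vertex – …; either node 4 is an interior vertex
  carrying the two distinct edges at nodes 2 and 6, or the path is `w₁ – c – e – c' – w₂` (one edge).

The three adjacency-inversion lemmas are private here (abc-iut-L3-t6's `SubdivisionLemmas.lean`, p404972,
states them publicly as `subdivision_adj_inl_iff` etc.; this file avoids importing it only because its
olean was not yet built at filing time). Nothing here bears on anything disputed.
-/

namespace Literature.AnabelianGeometry.SemiGraphs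

namespace SemiGraph

open CategoryTheory

universe u

variable {G : SemiGraph.{u}}

/-! ### Local structure of the barycentric subdivision (cf. abc-iut-L3-t6's `SubdivisionLemmas`) -/

/-- Adjacency in the subdivision is the symmetrised incidence relation.
[cite: MochizukiSemiAnbd2006, §1 pp.11-12] -/
private theorem adj_iff {x y : G.Node} : G.subdivision.Adj x y ↔ x ≠ y ∧ (G.NodeRel x y ∨ G.NodeRel y x) :=
  SimpleGraph.fromRel_adj _ _ _

/-- The neighbours of a vertex-point are the points of the branches abutting to it.
[cite: MochizukiSemiAnbd2006, §1 pp.11-12] -/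
private theorem adj_inl_iff (v : G.Vertex) (y : G.Node) :
    G.subdivision.Adj (Sum.inl v) y ↔ ∃ b : G.Branch, G.abuts b = some v ∧ y = Sum.inr (Sum.inr b) := by
  rw [adj_iff]
  constructor
  · rintro ⟨-, h | h⟩
    · rcases h
    · rcases h with _ | ⟨b, w, hb⟩
      exact ⟨b, hb, rfl⟩
  · rintro ⟨b, hb, rfl⟩
    exact ⟨by simp, Or.inr (NodeRel.branch_vertex b v hb)⟩

/-- The neighbours of an edge-point are the points of its branches. [cite: MochizukiSemiAnbd2006, §1 pp.11-12] -/
private theorem adj_edge_iff (e : G.Edge) (y : G.Node) :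
    G.subdivision.Adj (Sum.inr (Sum.inl e)) y ↔ ∃ b : G.Branch, G.edgeOf b = e ∧ y = Sum.inr (Sum.inr b) := by
  rw [adj_iff]
  constructor
  · rintro ⟨-, h | h⟩
    · rcases h with ⟨b⟩
      exact ⟨b, rfl, rfl⟩
    · generalize hx : (Sum.inr (Sum.inl e) : G.Node) = x at h
      rcases h with ⟨b⟩ | ⟨b, w, hb⟩
      · simp at hx
      · simp at hx
  · rintro ⟨b, rfl, rfl⟩
    exact ⟨by simp, Or.inl (NodeRel.edge_branch b)⟩

/-- The neighbours of a branch-point are the point of its edge and the vertex it abuts to (if any).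
[cite: MochizukiSemiAnbd2006, §1 pp.11-12] -/
private theorem adj_branch_iff (b : G.Branch) (y : G.Node) :
    G.subdivision.Adj (Sum.inr (Sum.inr b)) y ↔
      y = Sum.inr (Sum.inl (G.edgeOf b)) ∨ ∃ v : G.Vertex, G.abuts b = some v ∧ y = Sum.inl v := by
  rw [adj_iff]
  constructor
  · rintro ⟨-, h | h⟩
    · generalize hx : (Sum.inr (Sum.inr b) : G.Node) = x at h
      rcases h with ⟨c⟩ | ⟨c, w, hc⟩
      · simp at hx
      · have hcb : c = b := by simpa using hx.symm
        subst hcb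
        exact Or.inr ⟨w, hc, rfl⟩
    · generalize hx : (Sum.inr (Sum.inr b) : G.Node) = x at h
      rcases h with ⟨c⟩ | ⟨c, w, hc⟩
      · have hcb : c = b := by simpa using hx.symm
        subst hcb
        exact Or.inl rfl
      · simp at hx
  · rintro (rfl | ⟨v, hb, rfl⟩)
    · exact ⟨by simp, Or.inr (NodeRel.edge_branch b)⟩
    · exact ⟨by simp, Or.inl (NodeRel.branch_vertex b v hb)⟩

/-! ### Two facts about edges of a tree -/

/-- The two branches of an edge: a branch of `e` other than `c` is determined (every edge "is a set of
cardinality precisely 2", p. 11). [cite: MochizukiSemiAnbd2006, §1 p.11] -/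
theorem branch_eq_of_ne_of_ne {e : G.Edge} {c b b' : G.Branch} (hc : G.edgeOf c = e)
    (hb : G.edgeOf b = e) (hb' : G.edgeOf b' = e) (h : b ≠ c) (h' : b' ≠ c) : b = b' := by
  obtain ⟨b₁, b₂, -, -, -, hall⟩ := G.two_branches e
  rcases hall c hc with rfl | rfl <;> rcases hall b hb with rfl | rfl <;>
    rcases hall b' hb' with rfl | rfl <;> first | rfl | exact absurd rfl h | exact absurd rfl h'

/-- **In a tree an edge has at most one branch at a given vertex** (two branches of `e` abutting to `v`
would give the circuit `v – b₁ – e – b₂ – v` in the subdivision; here: two distinct paths `v – bᵢ – e`).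
[cite: MochizukiSemiAnbd2006, §1 p.13] -/
theorem branch_unique_of_isAcyclic (hG : G.subdivision.IsAcyclic) {b₁ b₂ : G.Branch} {v : G.Vertex}
    (he : G.edgeOf b₁ = G.edgeOf b₂) (h₁ : G.abuts b₁ = some v) (h₂ : G.abuts b₂ = some v) :
    b₁ = b₂ := by
  -- the two walks `v → bᵢ → e`
  have a₁ : G.subdivision.Adj (Sum.inl v) (Sum.inr (Sum.inr b₁)) := (adj_inl_iff v _).mpr ⟨b₁, h₁, rfl⟩
  have a₂ : G.subdivision.Adj (Sum.inl v) (Sum.inr (Sum.inr b₂)) := (adj_inl_iff v _).mpr ⟨b₂, h₂, rfl⟩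
  have c₁ : G.subdivision.Adj (Sum.inr (Sum.inr b₁)) (Sum.inr (Sum.inl (G.edgeOf b₂))) :=
    (adj_branch_iff b₁ _).mpr (Or.inl (by rw [he]))
  have c₂ : G.subdivision.Adj (Sum.inr (Sum.inr b₂)) (Sum.inr (Sum.inl (G.edgeOf b₂))) :=
    (adj_branch_iff b₂ _).mpr (Or.inl rfl)
  let p₁ : G.subdivision.Walk (Sum.inl v) (Sum.inr (Sum.inl (G.edgeOf b₂))) :=
    SimpleGraph.Walk.cons a₁ (SimpleGraph.Walk.cons c₁ SimpleGraph.Walk.nil)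
  let p₂ : G.subdivision.Walk (Sum.inl v) (Sum.inr (Sum.inl (G.edgeOf b₂))) :=
    SimpleGraph.Walk.cons a₂ (SimpleGraph.Walk.cons c₂ SimpleGraph.Walk.nil)
  have hp₁ : p₁.IsPath := by simp [p₁, SimpleGraph.Walk.isPath_def]
  have hp₂ : p₂.IsPath := by simp [p₂, SimpleGraph.Walk.isPath_def]
  have h := congrArg (fun q : G.subdivision.Path _ _ => q.1.getVert 1) (hG.path_unique ⟨p₁, hp₁⟩ ⟨p₂, hp₂⟩)
  simpa [p₁, p₂] using h

/-! ### Walking along a path of the subdivision -/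

section Steps

variable {x y : G.Node} (p : G.subdivision.Walk x y)

/-- After a vertex-point a walk visits a branch abutting to that vertex. [cite: MochizukiSemiAnbd2006, Lem. 1.8(ii) p.20] -/
theorem step_vertex {i : ℕ} (hi : i < p.length) {v : G.Vertex} (hx : p.getVert i = Sum.inl v) :
    ∃ c : G.Branch, G.abuts c = some v ∧ p.getVert (i + 1) = Sum.inr (Sum.inr c) := by
  have h := p.adj_getVert_succ hi
  rw [hx, adj_inl_iff] at h
  exact h

/-- After an edge-point a walk visits a branch of that edge. [cite: MochizukiSemiAnbd2006, Lem. 1.8(ii) p.20] -/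
theorem step_edge {i : ℕ} (hi : i < p.length) {e : G.Edge} (hx : p.getVert i = Sum.inr (Sum.inl e)) :
    ∃ c : G.Branch, G.edgeOf c = e ∧ p.getVert (i + 1) = Sum.inr (Sum.inr c) := by
  have h := p.adj_getVert_succ hi
  rw [hx, adj_edge_iff] at h
  exact h

/-- After a branch-point a walk visits the edge of the branch or the vertex it abuts to.
[cite: MochizukiSemiAnbd2006, Lem. 1.8(ii) p.20] -/
theorem step_branch {i : ℕ} (hi : i < p.length) {c : G.Branch}
    (hx : p.getVert i = Sum.inr (Sum.inr c)) :
    p.getVert (i + 1) = Sum.inr (Sum.inl (G.edgeOf c)) ∨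
      ∃ v : G.Vertex, G.abuts c = some v ∧ p.getVert (i + 1) = Sum.inl v := by
  have h := p.adj_getVert_succ hi
  rw [hx, adj_branch_iff] at h
  exact h

/-- A path does not back-track: `x_{i+2} ≠ x_i`. [cite: MochizukiSemiAnbd2006, Lem. 1.8(ii) p.20] -/
theorem getVert_add_two_ne (hp : p.IsPath) {i : ℕ} (hi : i + 2 ≤ p.length) :
    p.getVert (i + 2) ≠ p.getVert i := by
  intro h
  have := hp.getVert_injOn (by simp; omega) (by simp; omega) h
  omega

/-- On a path, a node that is not the endpoint sits at an index `< length`.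
[cite: MochizukiSemiAnbd2006, Lem. 1.8(ii) p.20] -/
theorem lt_length_of_getVert_ne {i : ℕ} (hi : i ≤ p.length) (h : p.getVert i ≠ y) : i < p.length := by
  rcases Nat.lt_or_ge i p.length with h' | h'
  · exact h'
  · exact absurd (by rw [le_antisymm hi h', SimpleGraph.Walk.getVert_length]) h

end Steps

/-! ### The dichotomy for a path between two distinct vertices -/

/-- **The shape of a geodesic between two distinct vertices `w₁ ≠ w₂` of a semi-graph**: along a path of
the subdivision from `w₁` to `w₂`, EITHER the fourth node is an interior vertex `v₁` carrying two DISTINCT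
edges `e₁ ≠ e₂` of the path (nodes 2 and 6) that abut to it, OR the path is `w₁ – c – e – c' – w₂` for a
single edge `e` abutting to both (via distinct branches). All nodes produced lie on the path.
[cite: MochizukiSemiAnbd2006, Lem. 1.8(ii)(c) p.20] -/
theorem path_between_vertices_shape {w₁ w₂ : G.Vertex} (hne : w₁ ≠ w₂)
    (p : G.subdivision.Walk (Sum.inl w₁) (Sum.inl w₂)) (hp : p.IsPath) :
    (∃ (v : G.Vertex) (e₁ e₂ : G.Edge) (c₁ c₂ : G.Branch), e₁ ≠ e₂ ∧ G.edgeOf c₁ = e₁ ∧ G.abuts c₁ = some v ∧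
        G.edgeOf c₂ = e₂ ∧ G.abuts c₂ = some v ∧ Sum.inl v ∈ p.support ∧
        Sum.inr (Sum.inl e₁) ∈ p.support ∧ Sum.inr (Sum.inl e₂) ∈ p.support) ∨
    (∃ (e : G.Edge) (c c' : G.Branch), c ≠ c' ∧ G.edgeOf c = e ∧ G.edgeOf c' = e ∧
        G.abuts c = some w₁ ∧ G.abuts c' = some w₂ ∧ Sum.inr (Sum.inl e) ∈ p.support) := by
  set n := p.length with hn
  have hx0 : p.getVert 0 = Sum.inl w₁ := p.getVert_zero
  have hxn : p.getVert n = Sum.inl w₂ := p.getVert_length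
  -- step 1: a branch `c₁` at `w₁`
  have h0n : 0 < n := lt_length_of_getVert_ne p (Nat.zero_le _) (by rw [hx0]; simpa using hne)
  obtain ⟨c₁, hc₁v, hx1⟩ := step_vertex p h0n hx0
  -- step 2: the edge `e₁` of `c₁`
  have h1n : 1 < n := lt_length_of_getVert_ne p h0n (by rw [hx1]; simp)
  have hx2 : p.getVert 2 = Sum.inr (Sum.inl (G.edgeOf c₁)) := by
    rcases step_branch p h1n hx1 with h | ⟨v, hv, h⟩
    · exact h
    · exfalso
      have hvw : v = w₁ := by rw [hc₁v] at hv; simpa using hv.symm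
      exact getVert_add_two_ne p hp (i := 0) (by omega) (by rw [h, hx0, hvw])
  -- step 3: the other branch `c₁'` of `e₁`
  have h2n : 2 < n := lt_length_of_getVert_ne p h1n (by rw [hx2]; simp)
  obtain ⟨c₁', hc₁'e, hx3⟩ := step_edge p h2n hx2
  have hcc : c₁' ≠ c₁ := by
    intro h
    exact getVert_add_two_ne p hp (i := 1) (by omega) (by rw [hx3, hx1, h])
  -- step 4: the vertex `v₁` of `c₁'`
  have h3n : 3 < n := lt_length_of_getVert_ne p h2n (by rw [hx3]; simp)
  obtain ⟨v₁, hc₁'v, hx4⟩ : ∃ v₁ : G.Vertex, G.abuts c₁' = some v₁ ∧ p.getVert 4 = Sum.inl v₁ := by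
    rcases step_branch p h3n hx3 with h | h
    · exfalso
      exact getVert_add_two_ne p hp (i := 2) (by omega) (by rw [h, hx2, hc₁'e])
    · exact h
  rcases Nat.lt_or_ge 4 n with h4n | h4n
  · -- interior vertex `v₁`: steps 5 and 6 give a second edge `e₂ ≠ e₁` at `v₁`
    left
    obtain ⟨c₂, hc₂v, hx5⟩ := step_vertex p h4n hx4
    have h5n : 5 < n := lt_length_of_getVert_ne p h4n (by rw [hx5]; simp)
    have hx6 : p.getVert 6 = Sum.inr (Sum.inl (G.edgeOf c₂)) := by
      rcases step_branch p h5n hx5 with h | ⟨v, hv, h⟩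
      · exact h
      · exfalso
        have hvv : v = v₁ := by rw [hc₂v] at hv; simpa using hv.symm
        exact getVert_add_two_ne p hp (i := 4) (by omega) (by rw [h, hx4, hvv])
    have hee : G.edgeOf c₁ ≠ G.edgeOf c₂ := by
      intro h
      have h26 : p.getVert 2 = p.getVert 6 := by rw [hx2, hx6, h]
      have := hp.getVert_injOn (by simp; omega) (by simp; omega) h26
      omega
    refine ⟨v₁, G.edgeOf c₁, G.edgeOf c₂, c₁', c₂, hee, hc₁'e, hc₁'v, rfl, hc₂v, ?_, ?_, ?_⟩
    · rw [← hx4]; exact p.getVert_mem_support 4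
    · rw [← hx2]; exact p.getVert_mem_support 2
    · rw [← hx6]; exact p.getVert_mem_support 6
  · -- `n = 4`: `w₁` and `w₂` are joined by the single edge `e₁`
    right
    have hn4 : n = 4 := le_antisymm h4n (by omega)
    have hvw : v₁ = w₂ := by
      have : p.getVert 4 = Sum.inl w₂ := by rw [← hn4]; exact hxn
      rw [hx4] at this
      simpa using this
    refine ⟨G.edgeOf c₁, c₁, c₁', fun h => hcc h.symm, rfl, hc₁'e, hc₁v, hvw ▸ hc₁'v, ?_⟩
    rw [← hx2]; exact p.getVert_mem_support 2

end SemiGraph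

end Literature.AnabelianGeometry.SemiGraphs
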